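import Mathlib
import Summits.KontsevichZagierPeriods.Zeta5Search.FamilyCellAAtlas
import Summits.KontsevichZagierPeriods.Zeta5Search.RecordCellAAtlasNotMin
import HarnessLib

/-!
# ζ(5) search — class atlas of the consecutive family at `(t+3)n < p < (t+4)n`, part 2: the non-minimal classes have `ν_x ≥ −3`

Cell `pub-zeta5` (HONEST FRAMING: systematic search; no irrationality claim unless certified), P1 prover seat
generation 5; continues `FamilyCellAAtlas.lean` (verbatim generalisation of `RecordCellAAtlasNotMin.lean`, `11n ↦ tn`).  For
`t ≥ 4`, `x < p` outside `FMinA ∪ FMinS ∪ FMinAbar` the termwise `V`-exponent `ν_x = classNu (bFam t n) p x` is at least `−3`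
(`classNu_ge_of_notFMin`), by the regions `x < tn` (tame single-pole class or `E_x = −3`), `tn ≤ x < tn+n`, `tn+n ≤ x < tn+2n`
off `FMinA`, `tn+2n ≤ x < tn+3n` off `FMinS` (incl. the self-conjugate class `2x + p = (3t+8)n`), `tn+3n ≤ x` off `FMinAbar`.
Exact arithmetic on the family; nothing about irrationality.
-/

open Finset

namespace Summit.KontsevichZagierPeriods.Zeta5Search.CellA

open Summit.KontsevichZagierPeriods.Zeta5Search.ClusterValuation
open Summit.KontsevichZagierPeriods.Zeta5Search.CasoratianValuation (shift)
open Summit.KontsevichZagierPeriods.Zeta5Search.BigPrime (block shift_zero)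
open Summit.KontsevichZagierPeriods.Zeta5Search.CellAtlas (bFam)

/-! ### The non-minimal classes of the family -/

section NotMin

variable {t n p x : ℕ} (hn : 1 ≤ n) (h4 : 4 * n ≤ t * n) (hp : t * n + 3 * n < p) (hp' : p < t * n + 4 * n)
  (hx : x < p)

include hp hp' hx in
/-- Three-point classes: the exponent sum. -/
theorem classExpF_ge_three (h3 : x + 2 * p ≤ (3 * (t * n) + 8 * n)) :
    netExp (bFam t n) x + netExp (bFam t n) (x + p) + netExp (bFam t n) (x + 2 * p) ≤ classExp (bFam t n) p x := by
  refine le_trans (le_of_eq ?_) (classExp_ge_sum _ _ _)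
  rw [classSet_bFam hp hp' hx, if_pos h3, sum_insert (by simp; omega), sum_pair (by omega)]; ring

include hp hp' hx in
/-- Two-point classes: the exponent sum. -/
theorem classExpF_ge_two (h3 : ¬ x + 2 * p ≤ (3 * (t * n) + 8 * n)) :
    netExp (bFam t n) x + netExp (bFam t n) (x + p) ≤ classExp (bFam t n) p x := by
  refine le_trans (le_of_eq ?_) (classExp_ge_sum _ _ _)
  rw [classSet_bFam hp hp' hx, if_neg h3, sum_pair (by omega)]

include hn hp hp' hx in
/-- Region `x < 11n`, third point beyond `29n`: a TAME single-pole class, `ν_x ≥ 0`. -/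
theorem classNuF_R0_tame (hx11 : x < (t * n)) (h29 : (2 * (t * n) + 7 * n) < x + 2 * p) : 0 ≤ classNu (bFam t n) p x := by
  have h3 : x + 2 * p ≤ (3 * (t * n) + 8 * n) := by omega
  have hcs := classSet_bFam hp hp' hx
  rw [if_pos h3] at hcs
  have ex : netExp (bFam t n) x = 1 := by
    rw [netExp_bFam_of_ne t n x (by omega), depF_low hx11]; norm_num
  have exp : netExp (bFam t n) (x + p) < 0 := by
    rw [netExp_bFam]; have := four_le_depF (t := t) (n := n) (q := x + p) (by omega) (by omega); split_ifs <;> omega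
  have ex2 : 0 ≤ netExp (bFam t n) (x + 2 * p) := by
    rw [netExp_bFam_of_ne t n (x + 2 * p) (by omega)]
    have : depF t n (x + 2 * p) ≤ 1 := by unfold depF; split_ifs <;> omega
    omega
  have hcount : classPoleCount (bFam t n) p x = 1 := by
    unfold classPoleCount
    rw [hcs, filter_insert, if_neg (by omega), filter_insert, if_pos exp, filter_singleton, if_neg (by omega)]
    simp
  have htm : tameSingle (bFam t n) p x = true := by
    rw [tameSingle_iff]
    refine ⟨x + p, by rw [hcs]; simp, exp, Or.inr fun s hs hlt => ?_⟩
    rw [hcs] at hs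
    simp only [mem_insert, mem_singleton] at hs
    rcases hs with rfl | rfl | rfl
    · rw [ex]; norm_num
    · omega
    · omega
  unfold classNu
  rw [if_pos ⟨hcount, htm⟩]
  exact le_max_right _ _

include hn h4 hp hp' hx in
/-- Region `x < 11n`, third point a simple pole (`x + 2p ≤ 29n`): `E_x = −3`. -/
theorem classExpF_R0 (hx11 : x < (t * n)) (h29 : x + 2 * p ≤ (2 * (t * n) + 7 * n)) : -3 ≤ classExp (bFam t n) p x := by
  refine le_trans ?_ (classExpF_ge_three hp hp' hx (by omega))
  have ex : netExp (bFam t n) x = 1 := by rw [netExp_bFam_of_ne t n x (by omega), depF_low hx11]; norm_num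
  have exp : netExp (bFam t n) (x + p) = -3 := by
    rw [netExp_bFam_of_ne t n (x + p) (by omega), depF_lower (k := 4) (by norm_num) (by norm_num) (by omega) (by omega)]; norm_num
  have ex2 : netExp (bFam t n) (x + 2 * p) = -1 := by
    rw [netExp_bFam_of_ne t n (x + 2 * p) (by omega), depF_upper (k := 2) (by norm_num) (by norm_num) (by omega) (by omega)]; norm_num
  rw [ex, exp, ex2]; norm_num

include h4 hp hp' hx in
/-- Region `11n ≤ x < 12n` (neutral point below a pole): `E_x ≥ −3`. -/
theorem classExpF_R1 (hx11 : (t * n) ≤ x) (hx12 : x < (t * n + n)) : -3 ≤ classExp (bFam t n) p x := by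
  have ex : netExp (bFam t n) x = 0 := by
    rw [netExp_bFam_of_ne t n x (by omega), depF_lower (k := 1) (by norm_num) (by norm_num) (by omega) (by omega)]; norm_num
  by_cases h3 : x + 2 * p ≤ (3 * (t * n) + 8 * n)
  · refine le_trans ?_ (classExpF_ge_three hp hp' hx h3)
    have exp : -4 ≤ netExp (bFam t n) (x + p) := by
      rw [netExp_bFam_of_ne t n (x + p) (by omega)]
      have : depF t n (x + p) ≤ 5 := by unfold depF; split_ifs <;> omega
      omega
    have ex2 : netExp (bFam t n) (x + 2 * p) = 1 := by
      rw [netExp_bFam_of_ne t n (x + 2 * p) (by omega), depF_high (by omega)]; norm_num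
    rw [ex, ex2]; omega
  · refine le_trans ?_ (classExpF_ge_two hp hp' hx h3)
    have exp : -3 ≤ netExp (bFam t n) (x + p) := by
      rw [netExp_bFam_of_ne t n (x + p) (by omega)]
      have : depF t n (x + p) ≤ 4 := by unfold depF; split_ifs <;> omega
      omega
    rw [ex]; omega

include h4 hp hp' hx in
/-- Region `12n ≤ x < 13n` outside `MinA`: `E_x ≥ −3`. -/
theorem classExpF_R2 (hx12 : (t * n + n) ≤ x) (hx13 : x < (t * n + 2 * n)) (hA : (2 * (t * n) + 5 * n) < x + p ∨ x + 2 * p ≤ (3 * (t * n) + 8 * n)) :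
    -3 ≤ classExp (bFam t n) p x := by
  have ex : netExp (bFam t n) x = -1 := by
    rw [netExp_bFam_of_ne t n x (by omega), depF_lower (k := 2) (by norm_num) (by norm_num) (by omega) (by omega)]; norm_num
  have exp : -3 ≤ netExp (bFam t n) (x + p) := by
    rw [netExp_bFam_of_ne t n (x + p) (by omega)]
    have : depF t n (x + p) ≤ 4 := by unfold depF; split_ifs <;> omega
    omega
  by_cases h3 : x + 2 * p ≤ (3 * (t * n) + 8 * n)
  · refine le_trans ?_ (classExpF_ge_three hp hp' hx h3)
    have ex2 : netExp (bFam t n) (x + 2 * p) = 1 := by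
      rw [netExp_bFam_of_ne t n (x + 2 * p) (by omega), depF_high (by omega)]; norm_num
    rw [ex, ex2]; omega
  · refine le_trans ?_ (classExpF_ge_two hp hp' hx h3)
    have h27 : (2 * (t * n) + 5 * n) < x + p := by omega
    have exp' : -2 ≤ netExp (bFam t n) (x + p) := by
      rw [netExp_bFam_of_ne t n (x + p) (by omega)]
      have : depF t n (x + p) ≤ 3 := by unfold depF; split_ifs <;> omega
      omega
    rw [ex]; omega

include hp hp' hx in
/-- Region `13n ≤ x < 14n` with `x + p > 28n`: `E_x ≥ −3`. -/
theorem classExpF_R3 (hx13 : (t * n + 2 * n) ≤ x) (hx14 : x < (t * n + 3 * n)) (h28 : (2 * (t * n) + 6 * n) < x + p) :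
    -3 ≤ classExp (bFam t n) p x := by
  refine le_trans ?_ (classExpF_ge_two hp hp' hx (by omega))
  have ex : netExp (bFam t n) x = -2 := by
    rw [netExp_bFam_of_ne t n x (by omega), depF_lower (k := 3) (by norm_num) (by norm_num) (by omega) (by omega)]; norm_num
  have exp : -1 ≤ netExp (bFam t n) (x + p) := by
    rw [netExp_bFam_of_ne t n (x + p) (by omega)]
    have : depF t n (x + p) ≤ 2 := by unfold depF; split_ifs <;> omega
    omega
  rw [ex]; omega

include hp hp' hx in
/-- The SELF-CONJUGATE class `2x + p = 41n` (odd `n`): two double poles, centre term `+1`, `E_x = −3`. -/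
theorem classExpF_R3_self (hodd : ¬ 2 ∣ p) (hx13 : (t * n + 2 * n) ≤ x) (h28 : x + p ≤ (2 * (t * n) + 6 * n))
    (hself : 2 * x + p = (3 * (t * n) + 8 * n)) : -3 ≤ classExp (bFam t n) p x := by
  have ex : netExp (bFam t n) x = -2 := by
    rw [netExp_bFam_of_ne t n x (by omega), depF_lower (k := 3) (by norm_num) (by norm_num) (by omega) (by omega)]; norm_num
  have exp : netExp (bFam t n) (x + p) = -2 := by
    rw [netExp_bFam_of_ne t n (x + p) (by omega), depF_upper (k := 3) (by norm_num) (by norm_num) (by omega) (by omega)]; norm_num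
  have hcen : ¬ (2 : ℤ) ∣ bFam t n 0 ∧ CentreIn (bFam t n) p x := by
    rw [CentreIn, bFam_val0]
    refine ⟨fun h2 => hodd ?_, ⟨-1, by omega⟩⟩
    have h2' : (2 : ℤ) ∣ (p : ℤ) := by
      have e : (p : ℤ) = ((3 * (t * n) + 8 * n : ℕ) : ℤ) - 2 * (x : ℤ) := by omega
      rw [e]; exact dvd_sub h2 (dvd_mul_right 2 _)
    exact Int.natCast_dvd_natCast.1 h2'
  have hsum : ∑ s ∈ classSet (bFam t n) p x, netExp (bFam t n) s = netExp (bFam t n) x + netExp (bFam t n) (x + p) := by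
    rw [classSet_bFam hp hp' hx, if_neg (by omega), sum_pair (by omega)]
  unfold classExp
  rw [if_pos hcen, hsum, ex, exp]; norm_num

include hn hp hp' hx in
/-- Region `14n ≤ x < p` with `x + p > 29n` (pole at level 0, neutral point above): `E_x = −3`. -/
theorem classExpF_R4 (hx14 : (t * n + 3 * n) ≤ x) (h29 : (2 * (t * n) + 7 * n) < x + p) : -3 ≤ classExp (bFam t n) p x := by
  refine le_trans ?_ (classExpF_ge_two hp hp' hx (by omega))
  have ex : netExp (bFam t n) x = -3 := by
    rw [netExp_bFam_of_ne t n x (by omega), depF_lower (k := 4) (by norm_num) (by norm_num) (by omega) (by omega)]; norm_num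
  have exp : 0 ≤ netExp (bFam t n) (x + p) := by
    rw [netExp_bFam_of_ne t n (x + p) (by omega)]
    have : depF t n (x + p) ≤ 1 := by unfold depF; split_ifs <;> omega
    omega
  rw [ex]; omega

include hn h4 hp hp' hx in
/-- **THE NON-MINIMAL CLASSES**: for `x < p` outside `MinA ∪ MinS ∪ MinAbar`, `ν_x(b(n), p) ≥ −3`. -/
theorem classNu_ge_of_notFMin (hodd : ¬ 2 ∣ p) (hA : x ∉ FMinA t n p) (hS : x ∉ FMinS t n p) (hB : x ∉ FMinAbar t n p) :
    -3 ≤ classNu (bFam t n) p x := by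
  rw [mem_fminA] at hA; rw [mem_fminS] at hS; rw [mem_fminAbar] at hB
  by_cases hx11 : x < (t * n)
  · by_cases h29 : (2 * (t * n) + 7 * n) < x + 2 * p
    · exact le_trans (by norm_num) (classNuF_R0_tame hn hp hp' hx hx11 h29)
    · exact le_trans (classExpF_R0 hn h4 hp hp' hx hx11 (by omega)) (classExp_le_classNu _ _ _)
  refine le_trans ?_ (classExp_le_classNu _ _ _)
  push Not at hx11
  by_cases hx12 : x < (t * n + n)
  · exact classExpF_R1 h4 hp hp' hx hx11 hx12
  push Not at hx12
  by_cases hx13 : x < (t * n + 2 * n)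
  · have hA' : (2 * (t * n) + 5 * n) < x + p ∨ x + 2 * p ≤ (3 * (t * n) + 8 * n) := by
      by_contra hc; push Not at hc; exact hA ⟨hx, hx12, hc.1, hc.2⟩
    exact classExpF_R2 h4 hp hp' hx hx12 hx13 hA'
  push Not at hx13
  by_cases hx14 : x < (t * n + 3 * n)
  · by_cases h28 : (2 * (t * n) + 6 * n) < x + p
    · exact classExpF_R3 hp hp' hx hx13 hx14 h28
    · have hself : 2 * x + p = (3 * (t * n) + 8 * n) := by
        by_contra hne; push Not at h28; exact hS ⟨hx, hx13, h28, hne⟩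
      exact classExpF_R3_self hp hp' hx hodd hx13 (by omega) hself
  · push Not at hx14
    have h29 : (2 * (t * n) + 7 * n) < x + p := by
      by_contra hle; push Not at hle; exact hB ⟨hx, hx14, hle⟩
    exact classExpF_R4 hn hp hp' hx hx14 h29

end NotMin

end Summit.KontsevichZagierPeriods.Zeta5Search.CellA
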